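import Literature.Analysis.FluidPDE.VorticityFormulationHolds
import Literature.Analysis.FluidPDE.LerayProfileCalculus
import Literature.Analysis.FluidPDE.TaoEnstrophyLocalisation
import HarnessLib

/-!
# The enstrophy density under `L = ∂ₜ + u·∇ − νΔ`: `L ‖ω‖² = 2 ⟪ω, (ω·∇)u⟫ − 2ν ‖∇ω‖²`
# (route `AdaptedFrequency`; items `AdaptedFrequencyConverges`, `FrequencyRigidity`,
# `TangentFlowTransfer` — stmt-NavierStokesRegularity-10493 / 2955 / 10494)

Helper file (all results proved). The first variation of the adapted enstrophy
`H(t) = ∫ ‖curl u(t)‖² G(t)` against a flow-adapted backward kernel `G` is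
`H′ = ∫ (∂ₜ + u·∇ − νΔ)‖ω‖² · G` (kernel calculus,
`AdaptedFrequencyTangentFlowTransferKernelCalculus`/`…Global`), and for a classical Navier–Stokes
solution the integrand is a purely spatial expression — the transport terms cancel against the
vorticity equation `∂ₜω + (u·∇)ω = (ω·∇)u + νΔω` (Majda–Bertozzi, (2.110); in the tree
`IsClassicalNSSolutionOn.isVorticitySolutionOn_of_uniqueDiffOn`):

  `(∂ₜ + u·∇ − νΔ) ‖ω‖² = 2 ⟪ω, (ω·∇)u⟫ − 2ν |∇ω|²`   (`opL_enstrophyDensity_eq`),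

the route's identity `H′ = 2∫(ω·Sω − ν|∇ω|²)G` at the level of densities (`⟪ω, (ω·∇)u⟫ = ω·Sω`
since the antisymmetric part of `∇u` drops out). Ingredients: `∂ₜ‖ω‖² = 2⟪ω, ∂ₜω⟫`
(`HasDerivWithinAt.inner`), `D‖ω‖²·u = 2⟪ω, (u·∇)ω⟫` (`fderiv_inner_apply`),
`Δ‖ω‖² = 2⟪Δω, ω⟫ + 2|∇ω|²` (`laplacian_inner_self_eq`, Tsai 1998). In particular only `u`,
`∇u`, `∇²u` (through `ω`, `∇ω`) enter the right-hand side, which is what lets `H_k′` be passed to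
a `C²_loc` blow-up limit in `TangentFlowTransfer`.

References: A. J. Majda, A. L. Bertozzi, *Vorticity and Incompressible Flow* (2002), §2.4
eq. (2.110); P. Constantin, Comm. Math. Phys. 129 (1990), (2.9) (the enstrophy density balance).
-/

noncomputable section

open MeasureTheory Set Function Filter TopologicalSpace Metric
open scoped Topology InnerProductSpace RealInnerProductSpace Laplacian

namespace Summit.NavierStokesRegularity.NavierStokesRegularity.Theorems

open Literature.Analysis Literature.Analysis.FluidPDE

variable {S : Set ℝ} {ν : ℝ} {u : ℝ → EuclideanSpace ℝ (Fin 3) → EuclideanSpace ℝ (Fin 3)}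
  {p : ℝ → EuclideanSpace ℝ (Fin 3) → ℝ}

/-- The vorticity of a classical solution is a jointly smooth field (`curl = curlCLM ∘ D`).
[folklore] -/
theorem isSmoothSpaceTimeOn_vorticity_of_classical (h : IsClassicalNSSolutionOn S ν 0 u p)
    (hS : UniqueDiffOn ℝ S) : IsSmoothSpaceTimeOn S (vorticity u) :=
  (h.smooth_velocity.fderiv_slice hS).clm_comp curlCLM

/-- The vorticity slices of a classical solution are `C²`. [folklore] -/
theorem contDiff_two_vorticity_of_classical (h : IsClassicalNSSolutionOn S ν 0 u p) {t : ℝ}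
    (ht : t ∈ S) : ContDiff ℝ 2 (vorticity u t) := by
  have h3 : ContDiff ℝ 3 (u t) := contDiff_infty.1 (h.contDiff_velocity ht) 3
  exact contDiff_curl (n := 2) (by exact_mod_cast h3)

/-- **The enstrophy density identity.** For a classical solution `(u, p)` of the unforced
Navier–Stokes system with viscosity `ν` on a time set `S` of unique differentiability, with
vorticity `ω = vorticity u`, at every `(t, x) ∈ S × ℝ³`:
`∂ₜ‖ω‖² + D(‖ω‖²)(x)[u] − ν Δ‖ω‖² = 2 ⟪ω, (ω·∇)u⟫ − 2ν |∇ω|²_F`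
(`|∇ω|²_F = frobeniusNormSq (Dω)`; the time derivative is the one-sided `timeDerivWithin S`).
Proof: expand the three derivatives of `‖ω‖² = ⟪ω, ω⟫` and insert the vorticity equation
`∂ₜω = νΔω − (u·∇)ω + (ω·∇)u`; the transport terms `∓2⟪ω, (u·∇)ω⟫` and the terms
`±2ν⟪ω, Δω⟫` cancel. [cite: MajdaBertozziCUP2002, §2.4 eq. (2.110) (vorticity equation)] -/
theorem opL_enstrophyDensity_eq (h : IsClassicalNSSolutionOn S ν 0 u p) (hS : UniqueDiffOn ℝ S)
    {t : ℝ} (ht : t ∈ S) (x : EuclideanSpace ℝ (Fin 3)) :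
    timeDerivWithin S (fun s y => ‖vorticity u s y‖ ^ 2) t x +
        fderiv ℝ (fun y => ‖vorticity u t y‖ ^ 2) x (u t x) -
        ν * (Δ fun y => ‖vorticity u t y‖ ^ 2) x =
      2 * ⟪vorticity u t x, convect (vorticity u t) (u t) x⟫ -
        2 * ν * frobeniusNormSq (fderiv ℝ (vorticity u t) x) := by
  set ω := vorticity u with hω
  have hωs : IsSmoothSpaceTimeOn S ω := isSmoothSpaceTimeOn_vorticity_of_classical h hS
  have hω2 : ContDiff ℝ 2 (ω t) := contDiff_two_vorticity_of_classical h ht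
  have hωd : ∀ y, DifferentiableAt ℝ (ω t) y := fun y => (hω2.differentiable (by norm_num)) y
  -- the vorticity equation
  have hV := (h.isVorticitySolutionOn_of_uniqueDiffOn hS (fun _ _ _ => by simp [curl])).vorticity_eq
    t ht x
  -- rewrite `‖·‖²` as an inner product
  have hsq : (fun s y => ‖ω s y‖ ^ 2) = fun s y => ⟪ω s y, ω s y⟫ := by
    funext s y; rw [real_inner_self_eq_norm_sq]
  have hsq' : (fun y => ‖ω t y‖ ^ 2) = fun y => ⟪ω t y, ω t y⟫ := by
    funext y; rw [real_inner_self_eq_norm_sq]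
  -- time derivative
  have htime : timeDerivWithin S (fun s y => ‖ω s y‖ ^ 2) t x =
      2 * ⟪ω t x, timeDerivWithin S ω t x⟫ := by
    rw [hsq, timeDerivWithin_apply]
    have hd := hωs.hasDerivWithinAt_timeDerivWithin hS ht x
    have h2 := hd.inner ℝ hd
    rw [h2.derivWithin (hS t ht), real_inner_comm]
    ring
  -- space derivative
  have hspace : fderiv ℝ (fun y => ‖ω t y‖ ^ 2) x (u t x) = 2 * ⟪ω t x, convect (u t) (ω t) x⟫ := by
    rw [hsq', fderiv_inner_apply ℝ (hωd x) (hωd x), convect_apply, real_inner_comm]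
    ring
  -- Laplacian
  have hlap : (Δ fun y => ‖ω t y‖ ^ 2) x = 2 * ⟪(Δ (ω t)) x, ω t x⟫ + 2 * frobeniusNormSq (fderiv ℝ (ω t) x) := by
    rw [hsq']
    exact laplacian_inner_self_eq hω2 x
  rw [htime, hspace, hlap]
  -- insert the vorticity equation `∂ₜω = (ω·∇)u + νΔω − (u·∇)ω`
  have hV' : timeDerivWithin S ω t x = convect (ω t) (u t) x + ν • (Δ (ω t)) x - convect (u t) (ω t) x :=
    eq_sub_of_add_eq hV
  rw [hV', inner_sub_right, inner_add_right, inner_smul_right]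
  linear_combination (2 * ν) * real_inner_comm ((Δ (ω t)) x) (ω t x)

/-- The same identity with the vorticity written as `curl (u t)` (the route's inline form of the
adapted enstrophy density `‖curl (u t) x‖²`). [cite: MajdaBertozziCUP2002, §2.4 eq. (2.110) (vorticity equation)] -/
theorem opL_norm_curl_sq_eq (h : IsClassicalNSSolutionOn S ν 0 u p) (hS : UniqueDiffOn ℝ S)
    {t : ℝ} (ht : t ∈ S) (x : EuclideanSpace ℝ (Fin 3)) :
    timeDerivWithin S (fun s y => ‖curl (u s) y‖ ^ 2) t x +
        fderiv ℝ (fun y => ‖curl (u t) y‖ ^ 2) x (u t x) -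
        ν * (Δ fun y => ‖curl (u t) y‖ ^ 2) x =
      2 * ⟪curl (u t) x, fderiv ℝ (u t) x (curl (u t) x)⟫ -
        2 * ν * frobeniusNormSq (fderiv ℝ (curl (u t)) x) := by
  have h1 := opL_enstrophyDensity_eq h hS ht x
  simp only [vorticity, convect_apply] at h1
  exact h1

end Summit.NavierStokesRegularity.NavierStokesRegularity.Theorems

end
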